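import Summits.QuantumFields.GaugeBoot.BootstrapCertificatesSuN
import Summits.QuantumFields.GaugeBoot.BootstrapGramCertificates
import Summits.QuantumFields.GaugeBoot.WordSpaces
import HarnessLib

/-!
# Finite certificates: on a torus every strict bound on a Wilson expectation is proved by ONE positive semidefinite matrix indexed by finitely many words, plus loop-equation multipliers (gauge-boot, L1/L4 supplement)

HONEST FRAMING (cell `pub-gaugeboot`, page 1 of every file): the venture produces certified bounds
on lattice expectations at stated coupling, gauge group, dimension and torus size; NOT a mass gap,
NOT a continuum limit, NOT a string tension; NOT Yang–Mills-summit-bearing (barriers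
`FixedCouplingUltralocality`, `PerturbativeInvisibility`). Structural; it certifies no number and
exhibits no certificate.

## Content (`SU(N)` on `(ℤ/L)^d`, every `d`, `L ≥ 1`, `N`, every real `β`)

On a finite torus the words of length `≤ n` in the matrix entries of the link variables form a
FINITE set (`wordsUpTo_finite`, from `WordSpaces.wordsOn_finite`), enumerated by some
`m : Fin s → C(…)` (`exists_fin_range_eq_wordsUpTo`). Combining the Gram form of SOS elements
(`BootstrapGramCertificates`) with completeness (`BootstrapCertificatesSuN`):

* ★★★ `exists_gram_certificate_suN` — at every level `n`, every constant strictly above the level-`n`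
  SDP maximum of an objective of the certificate domain is certified by a positive semidefinite
  matrix `Q : Matrix (Fin s) (Fin s) ℝ` on an enumeration of the words of length `≤ n` and a
  combination `ρ` of level-`n` row elements: `c' • 1 - P = Σ_{ij} Q_{ij} m_i m_j + ρ`;
* ★★★ `exists_gram_certificate_of_wilson_lt_suN` — for every polynomial observable `P` and every
  `c > ∫ P dμ_β` there are a level `n`, an enumeration `m` of the words of length `≤ n`, a PSD
  matrix `Q` and a row combination `ρ` with `c • 1 - P = Σ_{ij} Q_{ij} m_i m_j + ρ` — exactly the
  data format of the cell's `certsdp` certificates and of their kernel replays; soundness of that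
  format is `gram_wilson_le_suN`.

References: Blekherman–Parrilo–Thomas (2012) §3.1; Anderson–Kruczenski (2017); Kazakov–Zheng
(2022); Josz–Henrion (2016). Folklore.
-/

noncomputable section

open MeasureTheory Filter Topology NormedSpace Matrix
open Literature.MathematicalPhysics.QuantumFieldTheory (LatticeRep Edge GaugeConfig wilsonAction
  wilsonMeasure)
open Literature.MathematicalPhysics.QuantumLattice

namespace Summit.QuantumFields.GaugeBoot

open OrderUnitDuality

/-! ## Finitely many words on a finite lattice -/

section Words

variable {ι : Type*} [Finite ι] {G : Type*} [Group G] [TopologicalSpace G] (r : LatticeRep G)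

/-- ★ **On a finite lattice there are finitely many words of each bounded length.** [folklore] -/
theorem wordsUpTo_finite (n : ℕ) : (wordsUpTo (ι := ι) r n).Finite := by
  rw [← wordsOn_univ]
  exact wordsOn_finite r Set.finite_univ n

/-- **An enumeration of the words of length `≤ n`** by `Fin s`. [folklore] -/
theorem exists_fin_range_eq_wordsUpTo (n : ℕ) :
    ∃ (s : ℕ) (m : Fin s → C(ι → G, ℝ)), Set.range m = wordsUpTo (ι := ι) r n := by
  obtain ⟨s, f, hf⟩ := (wordsUpTo_finite (ι := ι) r n).fin_embedding
  exact ⟨s, f, hf⟩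

omit [Finite ι] in
/-- The span of an enumeration of the words is the word truncation. -/
theorem span_range_eq_wordTruncation {n s : ℕ} {m : Fin s → C(ι → G, ℝ)}
    (hm : Set.range m = wordsUpTo (ι := ι) r n) :
    (Submodule.span ℝ (Set.range m) : Set C(ι → G, ℝ)) = wordTruncation (ι := ι) r n := by
  rw [hm]; rfl

end Words

/-! ## `SU(N)` on the torus: PSD-matrix certificates -/

section SuN

variable {d L : ℕ} [NeZero L] (N : ℕ) (β : ℝ)

/-- ★★ **Soundness of the certificate format**: a PSD matrix `Q` on words of length `≤ n` and a
level-`n` row combination `ρ` with `Σ Q_{ij} m_i m_j + ρ = c • 1 - P` prove `∫ P dμ_β ≤ c` (and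
bound every level-`n` feasible value). [folklore] -/
theorem gram_wilson_le_suN {n s : ℕ}
    {m : Fin s → C(GaugeConfig d L (Matrix.specialUnitaryGroup (Fin N) ℂ), ℝ)}
    (hm : ∀ i, m i ∈ wordTruncation (ι := Edge d L) (fundamentalLatticeRep N) n)
    {Q : Matrix (Fin s) (Fin s) ℝ} (hQ : Q.PosSemidef)
    {ρ : C(GaugeConfig d L (Matrix.specialUnitaryGroup (Fin N) ℂ), ℝ)}
    (hρ : ρ ∈ rowSpace (fundamentalLatticeRep N) (suExp N) (fun _ => wilsonAction (fundamentalRep (Fin N)))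
      β (wordTruncation (ι := Edge d L) (fundamentalLatticeRep N) n))
    {P : C(GaugeConfig d L (Matrix.specialUnitaryGroup (Fin N) ℂ), ℝ)} {c : ℝ}
    (hcert : gramForm m Q + ρ = c • (1 : C(GaugeConfig d L (Matrix.specialUnitaryGroup (Fin N) ℂ), ℝ)) - P) :
    ∫ U, P U ∂(wilsonMeasure (fundamentalRep (Fin N)) β) ≤ c :=
  wilson_le_of_mem_certCone_suN N β (hcert ▸ gram_add_mem_certCone (fundamentalLatticeRep N) m
    (Submodule.span ℝ (wordsUpTo (ι := Edge d L) (fundamentalLatticeRep N) n)) hm hQ hρ)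

/-- ★★★ **No duality gap, in certificate format**: at every level `n`, every constant strictly
above the level-`n` SDP maximum of `P` (in the certificate domain) is certified by ONE positive
semidefinite matrix on an enumeration of the words of length `≤ n` plus a row combination.
[folklore] -/
theorem exists_gram_certificate_suN {n : ℕ}
    {P : C(GaugeConfig d L (Matrix.specialUnitaryGroup (Fin N) ℂ), ℝ)}
    (hP : P ∈ certDomainSuN (d := d) (L := L) N β n) {c c' : ℝ}
    (h : ∀ t ∈ levelValuesSuN (d := d) (L := L) N β n P, t ≤ c) (hc : c < c') :
    ∃ (s : ℕ) (m : Fin s → C(GaugeConfig d L (Matrix.specialUnitaryGroup (Fin N) ℂ), ℝ)),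
      Set.range m = wordsUpTo (ι := Edge d L) (fundamentalLatticeRep N) n ∧
      ∃ Q : Matrix (Fin s) (Fin s) ℝ, Q.PosSemidef ∧
        ∃ ρ ∈ rowSpace (fundamentalLatticeRep N) (suExp N) (fun _ => wilsonAction (fundamentalRep (Fin N)))
          β (wordTruncation (ι := Edge d L) (fundamentalLatticeRep N) n),
          gramForm m Q + ρ = c' • (1 : C(GaugeConfig d L (Matrix.specialUnitaryGroup (Fin N) ℂ), ℝ)) - P := by
  obtain ⟨s, m, hm⟩ := exists_fin_range_eq_wordsUpTo (fundamentalLatticeRep N) (ι := Edge d L) n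
  obtain ⟨σ, hσ, ρ, hρ, hcert⟩ := exists_certificate_suN N β hP h hc
  rw [← span_range_eq_wordTruncation (fundamentalLatticeRep N) hm] at hσ
  obtain ⟨Q, hQ, rfl⟩ := exists_posSemidef_of_mem_sosCone m hσ
  exact ⟨s, m, hm, Q, hQ, ρ, hρ, hcert⟩

/-- ★★★ **Every strict upper bound on a Wilson expectation is proved by a finite PSD-matrix
certificate.** `SU(N)` on `(ℤ/L)^d`, any real `β`: for every polynomial observable `P` and every
`c > ∫ P dμ_β` there are a level `n`, an enumeration `m : Fin s → _` of the words of length `≤ n`,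
a positive semidefinite `Q : Matrix (Fin s) (Fin s) ℝ` and a combination `ρ` of level-`n`
loop-equation row elements with `c • 1 - P = Σ_{ij} Q_{ij} m_i m_j + ρ`. [folklore] -/
theorem exists_gram_certificate_of_wilson_lt_suN
    {P : C(GaugeConfig d L (Matrix.specialUnitaryGroup (Fin N) ℂ), ℝ)}
    (hP : P ∈ polyAlgebra (ι := Edge d L) (fundamentalLatticeRep N)) {c : ℝ}
    (hc : ∫ U, P U ∂(wilsonMeasure (fundamentalRep (Fin N)) β) < c) :
    ∃ (n s : ℕ) (m : Fin s → C(GaugeConfig d L (Matrix.specialUnitaryGroup (Fin N) ℂ), ℝ)),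
      Set.range m = wordsUpTo (ι := Edge d L) (fundamentalLatticeRep N) n ∧
      ∃ Q : Matrix (Fin s) (Fin s) ℝ, Q.PosSemidef ∧
        ∃ ρ ∈ rowSpace (fundamentalLatticeRep N) (suExp N) (fun _ => wilsonAction (fundamentalRep (Fin N)))
          β (wordTruncation (ι := Edge d L) (fundamentalLatticeRep N) n),
          gramForm m Q + ρ = c • (1 : C(GaugeConfig d L (Matrix.specialUnitaryGroup (Fin N) ℂ), ℝ)) - P := by
  obtain ⟨n, σ, hσ, ρ, hρ, hcert⟩ := exists_certificate_of_wilson_lt_suN N β hP hc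
  obtain ⟨s, m, hm⟩ := exists_fin_range_eq_wordsUpTo (fundamentalLatticeRep N) (ι := Edge d L) n
  rw [← span_range_eq_wordTruncation (fundamentalLatticeRep N) hm] at hσ
  obtain ⟨Q, hQ, rfl⟩ := exists_posSemidef_of_mem_sosCone m hσ
  exact ⟨n, s, m, hm, Q, hQ, ρ, hρ, hcert⟩

/-- ★★★ **Lower bounds likewise**: every `c < ∫ P dμ_β` is proved by a finite PSD-matrix
certificate `P - c • 1 = Σ Q_{ij} m_i m_j + ρ`. [folklore] -/
theorem exists_gram_certificate_of_lt_wilson_suN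
    {P : C(GaugeConfig d L (Matrix.specialUnitaryGroup (Fin N) ℂ), ℝ)}
    (hP : P ∈ polyAlgebra (ι := Edge d L) (fundamentalLatticeRep N)) {c : ℝ}
    (hc : c < ∫ U, P U ∂(wilsonMeasure (fundamentalRep (Fin N)) β)) :
    ∃ (n s : ℕ) (m : Fin s → C(GaugeConfig d L (Matrix.specialUnitaryGroup (Fin N) ℂ), ℝ)),
      Set.range m = wordsUpTo (ι := Edge d L) (fundamentalLatticeRep N) n ∧
      ∃ Q : Matrix (Fin s) (Fin s) ℝ, Q.PosSemidef ∧
        ∃ ρ ∈ rowSpace (fundamentalLatticeRep N) (suExp N) (fun _ => wilsonAction (fundamentalRep (Fin N)))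
          β (wordTruncation (ι := Edge d L) (fundamentalLatticeRep N) n),
          gramForm m Q + ρ = P - c • (1 : C(GaugeConfig d L (Matrix.specialUnitaryGroup (Fin N) ℂ), ℝ)) := by
  obtain ⟨n, σ, hσ, ρ, hρ, hcert⟩ := exists_certificate_of_lt_wilson_suN N β hP hc
  obtain ⟨s, m, hm⟩ := exists_fin_range_eq_wordsUpTo (fundamentalLatticeRep N) (ι := Edge d L) n
  rw [← span_range_eq_wordTruncation (fundamentalLatticeRep N) hm] at hσ
  obtain ⟨Q, hQ, rfl⟩ := exists_posSemidef_of_mem_sosCone m hσ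
  exact ⟨n, s, m, hm, Q, hQ, ρ, hρ, hcert⟩

end SuN

end Summit.QuantumFields.GaugeBoot

end
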